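import Summits.ABC.ABC.Theses.IsogenyGlueCongruence
import Summits.ABC.ABC.Theorems.SharpDegreeOfPolyDegree.Negative.ExponentFloor
import Summits.ABC.ABC.Theorems.IsogenyGlueCongruenceSharpDegreeOfPolyHeightPosition
import Literature.NumberTheory.EllipticCurves.HeightCovolumeBoundsProofs
import Literature.Barriers.ABC.SzpiroEpsilonCannotBeDroppedHolds

-- `Summit.ABC.ABC.…`: summit and sub-problem share the name `ABC` (single-conjunct summit, D-0017).
set_option linter.dupNamespace false

/-!
# `SharpDegreeOfPolyHeight` (stmt-ABC-16009) — negative lemma: the `ε` of the CONSEQUENT cannot be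
# dropped, not even up to a power of `log N`

`R' := SharpDegreeOfPolyHeight = (H → X)`, `H` the polynomial height conjecture for semistable
curves, `X = SemistableDegreeConjecture` (`∀ ε > 0 ∃ C, deg φ ≤ C · N^{2+ε}` for SOME parametrisation
datum at level `N_W` of every semistable globally minimal elliptic `W/ℚ`).  cdisprove seat
`refuter-cdisprove-stmt-ABC-16009-0` (2026-08-16).  The exponent floor of `X` BELOW `2` is landed
(`SharpDegreeOfPolyDegree.Negative.not_targetWithExponent_of_lt_two`, modulo `PeterssonLowerBound`,
which loses `N^ε`); this file settles the ENDPOINT.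

* `not_degreeBound_two_polylog_of_degCovol` — modulo ONE analytic input of
  Goldfeld–Hoffstein–Lieman type, a lower bound `deg(D) · covol(Λ_W) ≥ c · N/(log N)^a` for the data
  of semistable curves with `N ≥ N₀` (hypothesis `hΩ`), there are NO `C, A` with
  `deg ≤ C · N² · (log N)^A` for a datum of every semistable globally minimal `W/ℚ`.  Proof: Watkins'
  Lemma 2.1 `covol · |Δ_W|^{1/6} ≤ 14.045` (PROVED in the tree, `watkins2004_lemma_2_1_holds`) and
  Masser's semistable curves with `|Δ_min| > C' N⁶ (log N)^k` for every `k`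
  (`Masser.exists_semistable_curve_polylog_excess`, PROVED), on a global minimal model.
* `degCovol_of_peterssonLog` — `hΩ` follows from `(f, f) ≥ c · N/(log N)^a` (GHL: `a = 1`) by
  Zagier's identity and `c_Manin² ≥ 1` (`four_pi_sq_mul_peterssonProduct_re_le_deg_mul_covolume`,
  proved); `degCovol_of_watkins` — and from the first inequality of the vendored named fact
  `watkins2004_thm_5_1` (`deg ≥ (N/Ω) · 0.033/(2 log N)`, semistable, `N ≥ 20000`).
* `not_degreeBound_two_of_degCovol` / `…_of_watkins` — in particular no `deg ≤ C · N²`: the `ε` of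
  the modular-degree conjecture cannot be dropped — the modular-degree twin of the catalogued
  barriers `EpsilonCannotBeDropped` (abc) and `SzpiroEpsilonCannotBeDropped` (Szpiro).
* Read on the item: `epsZeroCrux_iff_not_polyHeight_of_degCovol` — `R'` with the `ε` of its
  consequent dropped is equivalent to `¬ H`, and (`not_abc_of_epsZeroCrux_of_degCovol`) implies
  `¬ ABC` (`ABC → H`, `SharpDegreeOfPolyHeight.polyHeight_of_abc`); `not_target_uniformConst_of_degCovol`
  — the quantifier-order strengthening `∃ C ∀ ε` of `X` is false as well (minimal datum, `ε → 0⁺`).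
  Both the hypothesis (`HypothesisFloor`,
  `StrengthenedConsequent.not_polyHeight_polylog`) and the consequent of `R'` begin strictly above
  their `N⁶ (log N)^k` resp. `N² (log N)^A` endpoints: `R'` is a pure exponent-lowering statement
  with no slack at either end.

Purely negative / boundary content; no Theses statement is asserted, no definition, no new named fact
(the analytic input is an explicit hypothesis, discharged by `watkins2004_thm_5_1` in the corollaries).
-/

noncomputable section

namespace Summit.ABC.ABC.Theorems.SharpDegreeOfPolyHeight.Negative

open Summit.ABC.ABC.Theses.IsogenyGlueCongruence
open Summit.ABC.ABC.Theorems.SharpDegreeOfPolyDegree.Negative (exists_globallyMinimal_model)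
open Literature.NumberTheory.EllipticCurves Literature.NumberTheory.EllipticCurves.ModularForms
open WeierstrassCurve CongruenceSubgroup

/-! ## 1. The `ε` of the consequent cannot be dropped (polylog form), modulo a GHL-type input -/

/-- **The `ε = 0` endpoint of `X` is false even with a polylogarithmic allowance, modulo a
degree–covolume lower bound of Goldfeld–Hoffstein–Lieman type.** Hypothesis `hΩ`:
`deg(D) · covol(Λ_W) ≥ c · N/(log N)^a` for every datum `D` at level `N = N_W ≥ N₀` of a semistable
globally minimal `W` (for instance from `(f,f) ≥ c' N/(log N)^a` and Zagier, or Watkins' Thm. 5.1).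
Conclusion: for no `C, A` does every semistable globally minimal `W/ℚ` carry a datum of degree
`≤ C · N² · (log N)^A`.  Proof: Watkins' Lemma 2.1 `covol · |Δ_W|^{1/6} ≤ 14.045` (proved) and
Masser's curve with `|Δ_min| > (B N (log N)^{A+a+1})⁶`, `B = 14.045 (max C 0 + 1)/c`, on a global
minimal model give `c N B log N < c N B`, i.e. `log N < 1`, against `N ≥ 3`.
[cite: Masser1990, Theorem and Lemma 1] [cite: Watkins2004, Lemma 2.1] -/
theorem not_degreeBound_two_polylog_of_degCovol
    (hΩ : ∃ a c : ℝ, 0 < c ∧ ∃ N₀ : ℕ, ∀ (W : WeierstrassCurve ℚ) [W.IsElliptic]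
      [W.IsGloballyMinimal] [NeZero (W.conductorNorm ℤ)], W.IsSemistable ℤ →
        N₀ ≤ W.conductorNorm ℤ → ∀ D : ModularParametrizationData W (W.conductorNorm ℤ),
          c * (W.conductorNorm ℤ : ℝ) / Real.log (W.conductorNorm ℤ) ^ a ≤
            (D.modularDegree : ℝ) * ZLattice.covolume D.L.lattice)
    (A : ℝ) :
    ¬ ∃ C : ℝ, ∀ (W : WeierstrassCurve ℚ) [W.IsElliptic] [W.IsGloballyMinimal]
      [NeZero (W.conductorNorm ℤ)], W.IsSemistable ℤ →
        ∃ D : ModularParametrizationData W (W.conductorNorm ℤ),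
          (D.modularDegree : ℝ) ≤
            C * (W.conductorNorm ℤ : ℝ) ^ 2 * Real.log (W.conductorNorm ℤ) ^ A := by
  rintro ⟨C, hdeg⟩
  obtain ⟨a, c, hc, N₀, hΩ⟩ := hΩ
  -- constants: `C₁ = max C 0 + 1 > 0`, `B = 14.045 C₁ / c`, Masser exponent `k = (A + a + 1) · 6`
  set C₁ : ℝ := max C 0 + 1 with hC₁
  have hC₁0 : 0 < C₁ := by rw [hC₁]; positivity
  have hCC₁ : C ≤ C₁ := by rw [hC₁]; linarith [le_max_left C 0]
  set B : ℝ := 14.045 * C₁ / c with hB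
  have hB0 : 0 < B := by rw [hB]; positivity
  have hcB : C₁ * 14.045 = c * B := by rw [hB]; field_simp
  obtain ⟨W, hW, hss, hN, hlt⟩ :=
    Literature.Barriers.ABC.Masser.exists_semistable_curve_polylog_excess ((A + a + 1) * 6)
      (B ^ 6) (max N₀ 3)
  haveI := hW
  obtain ⟨W₁, hE₁, hM₁, hss₁, hN₁, hΔ₁⟩ := exists_globallyMinimal_model W
  haveI := hE₁
  haveI := hM₁
  have hNpos : 0 < W₁.conductorNorm ℤ := by rw [hN₁]; omega
  haveI : NeZero (W₁.conductorNorm ℤ) := ⟨hNpos.ne'⟩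
  have hN₀ : N₀ ≤ W₁.conductorNorm ℤ := by rw [hN₁]; omega
  have hN3' : 3 ≤ W₁.conductorNorm ℤ := by rw [hN₁]; omega
  obtain ⟨D, hD⟩ := hdeg W₁ (hss₁ hss)
  have hΩD := hΩ W₁ (hss₁ hss) hN₀ D
  rw [← hN₁] at hlt
  -- abbreviations
  set N : ℝ := (W₁.conductorNorm ℤ : ℝ) with hNdef
  set L : ℝ := Real.log N with hLdef
  set Ω : ℝ := ZLattice.covolume D.L.lattice with hΩdef
  set Δ : ℝ := ((|W₁.Δ| : ℚ) : ℝ) with hΔdef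
  set d : ℝ := (D.modularDegree : ℝ) with hddef
  have hN3 : (3 : ℝ) ≤ N := by rw [hNdef]; exact_mod_cast hN3'
  have hN0 : 0 < N := by linarith
  have hL1 : 1 ≤ L := by
    rw [hLdef, Real.le_log_iff_exp_le hN0]
    exact (Real.exp_one_lt_d9.le.trans (by norm_num)).trans hN3
  have hL0 : 0 < L := by linarith
  have hΩ0 : 0 < Ω := ZLattice.covolume_pos D.L.lattice _
  have hd0 : 0 ≤ d := Nat.cast_nonneg _
  -- Watkins' Lemma 2.1 on the Néron lattice of the global minimal model
  have h21 : Ω * Δ ^ (1 / 6 : ℝ) ≤ 14.045 := watkins2004_lemma_2_1_holds W₁ D.L D.isNeronLattice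
  -- Masser: `(B N L^{A+a+1})⁶ < Δ`, hence `B N L^{A+a+1} < Δ^{1/6}`
  have hpow : (B * N * L ^ (A + a + 1)) ^ 6 = B ^ 6 * N ^ 6 * L ^ ((A + a + 1) * 6) := by
    rw [mul_pow, mul_pow, Real.rpow_mul hL0.le, show ((6 : ℝ)) = ((6 : ℕ) : ℝ) by norm_num,
      Real.rpow_natCast]
  have hM : (B * N * L ^ (A + a + 1)) ^ 6 < Δ := by
    rw [hpow, hΔ₁]; exact hlt
  have hbase : 0 ≤ B * N * L ^ (A + a + 1) :=
    mul_nonneg (mul_nonneg hB0.le hN0.le) (Real.rpow_nonneg hL0.le _)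
  have hroot : B * N * L ^ (A + a + 1) < Δ ^ (1 / 6 : ℝ) := by
    have h := Real.rpow_lt_rpow (pow_nonneg hbase 6) hM (by norm_num : (0 : ℝ) < 1 / 6)
    have h6 : ((B * N * L ^ (A + a + 1)) ^ 6) ^ (1 / 6 : ℝ) = B * N * L ^ (A + a + 1) := by
      rw [one_div, show ((6 : ℝ))⁻¹ = ((6 : ℕ) : ℝ)⁻¹ by norm_num]
      exact Real.pow_rpow_inv_natCast hbase (by norm_num)
    rwa [h6] at h
  -- hence `Ω · (B N L^{A+a+1}) < 14.045`
  have h3 : Ω * (B * N * L ^ (A + a + 1)) < 14.045 :=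
    lt_of_lt_of_le (mul_lt_mul_of_pos_left hroot hΩ0) h21
  -- `c N ≤ d Ω L^a` from `hΩD`
  have hLa : 0 < L ^ a := Real.rpow_pos_of_pos hL0 _
  have h1 : c * N ≤ d * Ω * L ^ a := by
    have := hΩD
    rw [div_le_iff₀ hLa] at this
    exact this
  -- `d ≤ C₁ N² L^A`
  have hLA : 0 ≤ L ^ A := Real.rpow_nonneg hL0.le _
  have h2 : d ≤ C₁ * N ^ 2 * L ^ A :=
    hD.trans (mul_le_mul_of_nonneg_right (mul_le_mul_of_nonneg_right hCC₁ (sq_nonneg _)) hLA)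
  -- split `L^{A+a+1} = L^A · L^a · L`
  have h4 : L ^ (A + a + 1) = L ^ A * L ^ a * L := by
    rw [Real.rpow_add hL0, Real.rpow_add hL0, Real.rpow_one]
  -- the contradiction `c N B L < c N B`
  have key : c * N * B * L < c * N * B * 1 := by
    calc c * N * B * L ≤ d * Ω * L ^ a * B * L := by
          have := mul_le_mul_of_nonneg_right (mul_le_mul_of_nonneg_right h1 hB0.le) hL0.le
          linarith
      _ ≤ C₁ * N ^ 2 * L ^ A * Ω * L ^ a * B * L := by
          have hfac : 0 ≤ Ω * L ^ a * B * L :=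
            mul_nonneg (mul_nonneg (mul_nonneg hΩ0.le hLa.le) hB0.le) hL0.le
          have := mul_le_mul_of_nonneg_right h2 hfac
          nlinarith [this]
      _ = C₁ * N * (Ω * (B * N * L ^ (A + a + 1))) := by rw [h4]; ring
      _ < C₁ * N * 14.045 := mul_lt_mul_of_pos_left h3 (mul_pos hC₁0 hN0)
      _ = c * N * B * 1 := by
          rw [show C₁ * N * 14.045 = N * (C₁ * 14.045) by ring, hcB]; ring
  have hcNB : 0 < c * N * B := mul_pos (mul_pos hc hN0) hB0
  have : L < 1 := lt_of_mul_lt_mul_left key hcNB.le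
  linarith

/-- **The `ε = 0` endpoint proper** (no logarithm): modulo the same input there is no `C` with
`deg ≤ C · N²` for a datum of every semistable globally minimal `W/ℚ` — `ε` cannot be dropped in the
modular-degree conjecture `X`. [cite: Masser1990, Theorem and Lemma 1] -/
theorem not_degreeBound_two_of_degCovol
    (hΩ : ∃ a c : ℝ, 0 < c ∧ ∃ N₀ : ℕ, ∀ (W : WeierstrassCurve ℚ) [W.IsElliptic]
      [W.IsGloballyMinimal] [NeZero (W.conductorNorm ℤ)], W.IsSemistable ℤ →
        N₀ ≤ W.conductorNorm ℤ → ∀ D : ModularParametrizationData W (W.conductorNorm ℤ),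
          c * (W.conductorNorm ℤ : ℝ) / Real.log (W.conductorNorm ℤ) ^ a ≤
            (D.modularDegree : ℝ) * ZLattice.covolume D.L.lattice) :
    ¬ ∃ C : ℝ, ∀ (W : WeierstrassCurve ℚ) [W.IsElliptic] [W.IsGloballyMinimal]
      [NeZero (W.conductorNorm ℤ)], W.IsSemistable ℤ →
        ∃ D : ModularParametrizationData W (W.conductorNorm ℤ),
          (D.modularDegree : ℝ) ≤ C * (W.conductorNorm ℤ : ℝ) ^ 2 := by
  rintro ⟨C, h⟩
  refine not_degreeBound_two_polylog_of_degCovol hΩ 0 ⟨C, fun W _ _ _ hss => ?_⟩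
  obtain ⟨D, hD⟩ := h W hss
  exact ⟨D, by rwa [Real.rpow_zero, mul_one]⟩

/-- **The degree–covolume input from a GHL-type Petersson lower bound.** If the newforms of the data
of semistable curves satisfy `(f, f) ≥ c · N/(log N)^a` for `N ≥ N₀` (Goldfeld–Hoffstein–Lieman:
`L(1, Sym² f) ≫ 1/log N`, so `a = 1`; Hoffstein–Lockhart 1994 with the GHL appendix), then
`deg · covol ≥ 4π² c · N/(log N)^a` by Zagier's identity and `c_Manin² ≥ 1`
(`four_pi_sq_mul_peterssonProduct_re_le_deg_mul_covolume`, proved). [cite: HoffsteinLockhart1994, Thm. 0.1 and Appendix] -/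
theorem degCovol_of_peterssonLog
    (hP : ∃ a c : ℝ, 0 < c ∧ ∃ N₀ : ℕ, ∀ (W : WeierstrassCurve ℚ) [W.IsElliptic]
      [W.IsGloballyMinimal] [NeZero (W.conductorNorm ℤ)], W.IsSemistable ℤ →
        N₀ ≤ W.conductorNorm ℤ → ∀ D : ModularParametrizationData W (W.conductorNorm ℤ),
          c * (W.conductorNorm ℤ : ℝ) / Real.log (W.conductorNorm ℤ) ^ a ≤
            (peterssonProduct (Gamma0 (W.conductorNorm ℤ)) 2 D.f D.f).re) :
    ∃ a c : ℝ, 0 < c ∧ ∃ N₀ : ℕ, ∀ (W : WeierstrassCurve ℚ) [W.IsElliptic]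
      [W.IsGloballyMinimal] [NeZero (W.conductorNorm ℤ)], W.IsSemistable ℤ →
        N₀ ≤ W.conductorNorm ℤ → ∀ D : ModularParametrizationData W (W.conductorNorm ℤ),
          c * (W.conductorNorm ℤ : ℝ) / Real.log (W.conductorNorm ℤ) ^ a ≤
            (D.modularDegree : ℝ) * ZLattice.covolume D.L.lattice := by
  obtain ⟨a, c, hc, N₀, h⟩ := hP
  refine ⟨a, 4 * Real.pi ^ 2 * c, by positivity, N₀, fun W _ _ _ hss hN D => ?_⟩
  have h1 := h W hss hN D
  have h2 := four_pi_sq_mul_peterssonProduct_re_le_deg_mul_covolume D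
  have h3 := mul_le_mul_of_nonneg_left h1 (by positivity : (0 : ℝ) ≤ 4 * Real.pi ^ 2)
  calc 4 * Real.pi ^ 2 * c * (W.conductorNorm ℤ : ℝ) / Real.log (W.conductorNorm ℤ) ^ a
        = 4 * Real.pi ^ 2 * (c * (W.conductorNorm ℤ : ℝ) / Real.log (W.conductorNorm ℤ) ^ a) := by
          ring
    _ ≤ _ := h3.trans h2

/-- **The degree–covolume input from the vendored named fact `watkins2004_thm_5_1`** (its first
inequality, `deg ≥ (N/Ω) · 0.033/(2 log N)` for semistable `E`, `N ≥ 20000`): `a = 1`,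
`c = 0.033/2`.  (The tree records that the printed first inequality exceeds what Watkins' proof gives
by the factor `2π`, `HeightCovolumeBoundsProofs.lean`; constants are immaterial here, and the
corrected form gives the same conclusion with `c = 0.033/(4π)`.) [cite: Watkins2004, Theorem 5.1] -/
theorem degCovol_of_watkins (h : watkins2004_thm_5_1) :
    ∃ a c : ℝ, 0 < c ∧ ∃ N₀ : ℕ, ∀ (W : WeierstrassCurve ℚ) [W.IsElliptic]
      [W.IsGloballyMinimal] [NeZero (W.conductorNorm ℤ)], W.IsSemistable ℤ →
        N₀ ≤ W.conductorNorm ℤ → ∀ D : ModularParametrizationData W (W.conductorNorm ℤ),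
          c * (W.conductorNorm ℤ : ℝ) / Real.log (W.conductorNorm ℤ) ^ a ≤
            (D.modularDegree : ℝ) * ZLattice.covolume D.L.lattice := by
  refine ⟨1, 0.033 / 2, by norm_num, 20000, fun W _ _ _ hss hN D => ?_⟩
  have h1 := (h W hss hN D).1
  have hΩ : 0 < ZLattice.covolume D.L.lattice := ZLattice.covolume_pos D.L.lattice _
  have hN' : (20000 : ℝ) ≤ (W.conductorNorm ℤ : ℝ) := by exact_mod_cast hN
  have hlog : 0 < Real.log (W.conductorNorm ℤ : ℝ) := Real.log_pos (by linarith)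
  rw [Real.rpow_one]
  have h2 := mul_le_mul_of_nonneg_right h1 hΩ.le
  refine le_trans (le_of_eq ?_) h2
  field_simp

/-- **`ε` cannot be dropped in `X`, polylog form, modulo a GHL-type Petersson lower bound.** [cite: Masser1990, Theorem and Lemma 1] -/
theorem not_degreeBound_two_polylog_of_peterssonLog
    (hP : ∃ a c : ℝ, 0 < c ∧ ∃ N₀ : ℕ, ∀ (W : WeierstrassCurve ℚ) [W.IsElliptic]
      [W.IsGloballyMinimal] [NeZero (W.conductorNorm ℤ)], W.IsSemistable ℤ →
        N₀ ≤ W.conductorNorm ℤ → ∀ D : ModularParametrizationData W (W.conductorNorm ℤ),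
          c * (W.conductorNorm ℤ : ℝ) / Real.log (W.conductorNorm ℤ) ^ a ≤
            (peterssonProduct (Gamma0 (W.conductorNorm ℤ)) 2 D.f D.f).re)
    (A : ℝ) :
    ¬ ∃ C : ℝ, ∀ (W : WeierstrassCurve ℚ) [W.IsElliptic] [W.IsGloballyMinimal]
      [NeZero (W.conductorNorm ℤ)], W.IsSemistable ℤ →
        ∃ D : ModularParametrizationData W (W.conductorNorm ℤ),
          (D.modularDegree : ℝ) ≤
            C * (W.conductorNorm ℤ : ℝ) ^ 2 * Real.log (W.conductorNorm ℤ) ^ A :=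
  not_degreeBound_two_polylog_of_degCovol (degCovol_of_peterssonLog hP) A

/-- **`ε` cannot be dropped in `X`, polylog form, modulo the named fact `watkins2004_thm_5_1`.** [cite: Watkins2004, Theorem 5.1] [cite: Masser1990, Theorem and Lemma 1] -/
theorem not_degreeBound_two_polylog_of_watkins (h : watkins2004_thm_5_1) (A : ℝ) :
    ¬ ∃ C : ℝ, ∀ (W : WeierstrassCurve ℚ) [W.IsElliptic] [W.IsGloballyMinimal]
      [NeZero (W.conductorNorm ℤ)], W.IsSemistable ℤ →
        ∃ D : ModularParametrizationData W (W.conductorNorm ℤ),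
          (D.modularDegree : ℝ) ≤
            C * (W.conductorNorm ℤ : ℝ) ^ 2 * Real.log (W.conductorNorm ℤ) ^ A :=
  not_degreeBound_two_polylog_of_degCovol (degCovol_of_watkins h) A

/-- **`ε` cannot be dropped in `X` (no logarithm), modulo `watkins2004_thm_5_1`.** [cite: Watkins2004, Theorem 5.1] [cite: Masser1990, Theorem and Lemma 1] -/
theorem not_degreeBound_two_of_watkins (h : watkins2004_thm_5_1) :
    ¬ ∃ C : ℝ, ∀ (W : WeierstrassCurve ℚ) [W.IsElliptic] [W.IsGloballyMinimal]
      [NeZero (W.conductorNorm ℤ)], W.IsSemistable ℤ →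
        ∃ D : ModularParametrizationData W (W.conductorNorm ℤ),
          (D.modularDegree : ℝ) ≤ C * (W.conductorNorm ℤ : ℝ) ^ 2 :=
  not_degreeBound_two_of_degCovol (degCovol_of_watkins h)

/-- **Large modular degrees at the endpoint** (positive form, modulo the degree–covolume input): for
every `C, A` some semistable `W/ℚ` in global minimal form has ALL its data at level `N_W` of degree
`> C · N² · (log N)^A` — `lim sup deg φ_min / (N² (log N)^A) = ∞` along Masser's family. [cite: Masser1990, Theorem] -/
theorem exists_curve_forall_datum_gt_two_polylog_of_degCovol
    (hΩ : ∃ a c : ℝ, 0 < c ∧ ∃ N₀ : ℕ, ∀ (W : WeierstrassCurve ℚ) [W.IsElliptic]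
      [W.IsGloballyMinimal] [NeZero (W.conductorNorm ℤ)], W.IsSemistable ℤ →
        N₀ ≤ W.conductorNorm ℤ → ∀ D : ModularParametrizationData W (W.conductorNorm ℤ),
          c * (W.conductorNorm ℤ : ℝ) / Real.log (W.conductorNorm ℤ) ^ a ≤
            (D.modularDegree : ℝ) * ZLattice.covolume D.L.lattice)
    (C A : ℝ) :
    ∃ (W : WeierstrassCurve ℚ) (_ : W.IsElliptic) (_ : W.IsGloballyMinimal)
      (_ : NeZero (W.conductorNorm ℤ)), W.IsSemistable ℤ ∧
        ∀ D : ModularParametrizationData W (W.conductorNorm ℤ),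
          C * (W.conductorNorm ℤ : ℝ) ^ 2 * Real.log (W.conductorNorm ℤ) ^ A <
            (D.modularDegree : ℝ) := by
  by_contra hcon
  push Not at hcon
  exact not_degreeBound_two_polylog_of_degCovol hΩ A ⟨C, fun W hE hM hN hss => hcon W hE hM hN hss⟩

/-! ## 2. Read on the item: the `ε = 0` strengthening of `R'` is `¬ H`, hence refutes the summit -/

/-- **The item with the `ε` of its consequent dropped is equivalent to `¬ H`** (modulo the
degree–covolume input of Goldfeld–Hoffstein–Lieman type): "`H ⟹ deg φ ≤ C · N²` for a datum of every
semistable curve" holds iff the polynomial height conjecture FAILS. So `R'` cannot be sharpened at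
the endpoint of its consequent any more than below it (`strengthenedCrux_iff_not_polyHeight_of_lt_two`).
[cite: Masser1990, Theorem and Lemma 1] -/
theorem epsZeroCrux_iff_not_polyHeight_of_degCovol
    (hΩ : ∃ a c : ℝ, 0 < c ∧ ∃ N₀ : ℕ, ∀ (W : WeierstrassCurve ℚ) [W.IsElliptic]
      [W.IsGloballyMinimal] [NeZero (W.conductorNorm ℤ)], W.IsSemistable ℤ →
        N₀ ≤ W.conductorNorm ℤ → ∀ D : ModularParametrizationData W (W.conductorNorm ℤ),
          c * (W.conductorNorm ℤ : ℝ) / Real.log (W.conductorNorm ℤ) ^ a ≤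
            (D.modularDegree : ℝ) * ZLattice.covolume D.L.lattice) :
    ((∃ σ C : ℝ, ∀ (W : WeierstrassCurve ℚ) [W.IsElliptic] [W.IsGloballyMinimal]
        [NeZero (W.conductorNorm ℤ)], W.IsSemistable ℤ →
          ((max |W.Δ| (|W.c₄| ^ 3) : ℚ) : ℝ) ≤ C * (W.conductorNorm ℤ : ℝ) ^ σ) →
      ∃ C : ℝ, ∀ (W : WeierstrassCurve ℚ) [W.IsElliptic] [W.IsGloballyMinimal]
        [NeZero (W.conductorNorm ℤ)], W.IsSemistable ℤ →
          ∃ D : ModularParametrizationData W (W.conductorNorm ℤ),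
            (D.modularDegree : ℝ) ≤ C * (W.conductorNorm ℤ : ℝ) ^ 2) ↔
    ¬ ∃ σ C : ℝ, ∀ (W : WeierstrassCurve ℚ) [W.IsElliptic] [W.IsGloballyMinimal]
        [NeZero (W.conductorNorm ℤ)], W.IsSemistable ℤ →
          ((max |W.Δ| (|W.c₄| ^ 3) : ℚ) : ℝ) ≤ C * (W.conductorNorm ℤ : ℝ) ^ σ :=
  ⟨fun h hH => not_degreeBound_two_of_degCovol hΩ (h hH), fun h hH => absurd hH h⟩

/-- **… and therefore refutes the summit** (`ABC → H`, `SharpDegreeOfPolyHeight.polyHeight_of_abc`).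
Instance: modulo `watkins2004_thm_5_1`, a proof of "`H ⟹ deg φ ≤ C N²`" is a disproof of `ABC`.
[cite: BombieriGubler2006, Thm. 12.5.12] -/
theorem not_abc_of_epsZeroCrux_of_degCovol
    (hΩ : ∃ a c : ℝ, 0 < c ∧ ∃ N₀ : ℕ, ∀ (W : WeierstrassCurve ℚ) [W.IsElliptic]
      [W.IsGloballyMinimal] [NeZero (W.conductorNorm ℤ)], W.IsSemistable ℤ →
        N₀ ≤ W.conductorNorm ℤ → ∀ D : ModularParametrizationData W (W.conductorNorm ℤ),
          c * (W.conductorNorm ℤ : ℝ) / Real.log (W.conductorNorm ℤ) ^ a ≤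
            (D.modularDegree : ℝ) * ZLattice.covolume D.L.lattice)
    (h : (∃ σ C : ℝ, ∀ (W : WeierstrassCurve ℚ) [W.IsElliptic] [W.IsGloballyMinimal]
        [NeZero (W.conductorNorm ℤ)], W.IsSemistable ℤ →
          ((max |W.Δ| (|W.c₄| ^ 3) : ℚ) : ℝ) ≤ C * (W.conductorNorm ℤ : ℝ) ^ σ) →
      ∃ C : ℝ, ∀ (W : WeierstrassCurve ℚ) [W.IsElliptic] [W.IsGloballyMinimal]
        [NeZero (W.conductorNorm ℤ)], W.IsSemistable ℤ →
          ∃ D : ModularParametrizationData W (W.conductorNorm ℤ),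
            (D.modularDegree : ℝ) ≤ C * (W.conductorNorm ℤ : ℝ) ^ 2) : ¬ ABC :=
  fun habc => (epsZeroCrux_iff_not_polyHeight_of_degCovol hΩ).mp h
    (Summit.ABC.ABC.Theorems.SharpDegreeOfPolyHeight.polyHeight_of_abc habc)

/-- **The quantifier-order strengthening of `X` is false too** (modulo the degree–covolume input):
there is no constant `C` serving EVERY `ε > 0` in `X` ("`∃ C ∀ ε`" instead of "`∀ ε ∃ C`").  Degrees
being positive integers, a datum of minimal degree exists, and letting `ε → 0⁺` in
`deg_min ≤ C N^{2+ε}` gives `deg_min ≤ C N²` for every semistable curve, against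
`not_degreeBound_two_of_degCovol`.  (The limit step is the sibling crux workfile's
`degreeBound_two_of_const_uniform_in_eps`, Cruxes/SharpDegreeOfPolyDegree/Disproof.lean, which
recorded the endpoint as NOT refutable without a GHL-type input — supplied here as `hΩ`.) [folklore] -/
theorem not_target_uniformConst_of_degCovol
    (hΩ : ∃ a c : ℝ, 0 < c ∧ ∃ N₀ : ℕ, ∀ (W : WeierstrassCurve ℚ) [W.IsElliptic]
      [W.IsGloballyMinimal] [NeZero (W.conductorNorm ℤ)], W.IsSemistable ℤ →
        N₀ ≤ W.conductorNorm ℤ → ∀ D : ModularParametrizationData W (W.conductorNorm ℤ),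
          c * (W.conductorNorm ℤ : ℝ) / Real.log (W.conductorNorm ℤ) ^ a ≤
            (D.modularDegree : ℝ) * ZLattice.covolume D.L.lattice) :
    ¬ ∃ C : ℝ, ∀ ε : ℝ, 0 < ε → ∀ (W : WeierstrassCurve ℚ) [W.IsElliptic] [W.IsGloballyMinimal]
      [NeZero (W.conductorNorm ℤ)], W.IsSemistable ℤ →
        ∃ D : ModularParametrizationData W (W.conductorNorm ℤ),
          (D.modularDegree : ℝ) ≤ C * (W.conductorNorm ℤ : ℝ) ^ (2 + ε) := by
  rintro ⟨C, hC⟩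
  refine not_degreeBound_two_of_degCovol hΩ ⟨C, fun W _ _ _ hss => ?_⟩
  -- a datum of minimal degree
  have hne : ∃ m : ℕ, ∃ D : ModularParametrizationData W (W.conductorNorm ℤ),
      D.modularDegree = m := by
    obtain ⟨D, -⟩ := hC 1 one_pos W hss
    exact ⟨_, D, rfl⟩
  classical
  obtain ⟨D₀, hD₀⟩ := Nat.find_spec hne
  refine ⟨D₀, ?_⟩
  have hmin : ∀ D : ModularParametrizationData W (W.conductorNorm ℤ),
      D₀.modularDegree ≤ D.modularDegree := fun D => by
    rw [hD₀]
    exact Nat.find_min' hne ⟨D, rfl⟩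
  have hN0 : (0 : ℝ) < (W.conductorNorm ℤ : ℝ) := by
    exact_mod_cast NeZero.pos (W.conductorNorm ℤ)
  have hdeg : ∀ ε : ℝ, 0 < ε →
      (D₀.modularDegree : ℝ) ≤ C * (W.conductorNorm ℤ : ℝ) ^ (2 + ε) := by
    intro ε hε
    obtain ⟨D, hD⟩ := hC ε hε W hss
    exact le_trans (by exact_mod_cast hmin D) hD
  -- let `ε → 0⁺`
  have ht : Filter.Tendsto (fun ε : ℝ => C * (W.conductorNorm ℤ : ℝ) ^ (2 + ε))
      (nhdsWithin 0 (Set.Ioi 0)) (nhds (C * (W.conductorNorm ℤ : ℝ) ^ (2 + (0 : ℝ)))) := by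
    apply Filter.Tendsto.const_mul
    have h1 : Filter.Tendsto (fun ε : ℝ => 2 + ε) (nhdsWithin 0 (Set.Ioi 0)) (nhds (2 + 0)) :=
      ((continuous_const_add (2 : ℝ)).tendsto 0).mono_left nhdsWithin_le_nhds
    exact (Real.continuousAt_const_rpow hN0.ne').tendsto.comp h1
  rw [add_zero, Real.rpow_two] at ht
  refine ge_of_tendsto ht ?_
  filter_upwards [self_mem_nhdsWithin] with ε hε
  exact hdeg ε hε

end Summit.ABC.ABC.Theorems.SharpDegreeOfPolyHeight.Negative

end
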